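import Mathlib
import HarnessLib
import HarnessLib.Audit
import Summits.HubbardSuperconductivity.Statement
import Literature.MathematicalPhysics.QuantumLattice.NagaokaTasaki
import HarnessLib.Audit.Status.Attr

/-!
Route: HyperoctahedralMott

DORMANT since 2026-08-24T10:03:17Z (reconciler: no traction for 6.7 d (last activity item-evidence-added at 2026-08-17T16:57:53Z); parked, not closed — `ledger route dormant route-HubbardSuperconductivity-HyperoctahedralMott --off` to r) — unstaffed, not closed; items shared with open routes are served there. `ledger route dormant <id> --off` reactivates.

# Route HyperoctahedralMott — strong coupling inside C[Z₂≀S_M] — hole pairing as concavity of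
Aldous' λ₁ along fat hooks, anchored at the supersymmetric interchange point J = 2t

X := FatHookPairConcavity ∧ PureCooperPair ∧ DiluteBECBridge ("it suffices to show X"; realises card
hyperoctahedral-mott-algebra).
FatHookPairConcavity (the card's move, its (D5)/(D6) made a theorem target): on the even torus
(ℤ/Lℤ)², the smallest eigenvalue λ(N,M) of
the FERMIONIC INTERCHANGE LAPLACIAN Σ_⟨xy⟩(1 − π(xy)) — π(xy) the graded site swap, acting on the
Gutzwiller (no-doublon) sector with N
electrons and S^z = M — is strictly midpoint-concave across the three hole sectors 0, 1, 2 uniformly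
in L: λ(L²−2,0) + λ(L²,0) + ε ≤
2λ(L²−1,½). By the supersymmetric identity H_tJ(J=2t) = t·Σ_⟨xy⟩(1 − π(xy)) − 4t·N (support
SusyInterchangeIdentity) this IS uniform two-hole
binding of the t-J model at its supersymmetric point, and by wreath Schur–Weyl–Sergeev duality it is
an order relation between Aldous'
λ₁ in three fat-hook irrep families of S_{L²} for ONE element of the group algebra. PureCooperPair
(shared with route CooperPairDMottWalk):
the same Cooper pair — binding, uniqueness, macroscopic d-wave amplitude — for the PURE Hubbard
torus at some U ∈ [2,8], reached here by
descending J: 2t → t/2 inside the group algebra and a Schrieffer–Wolff transfer at U = 8.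
DiluteBECBridge (shared): bound dilute d-wave hole
pairs condense, giving HasDWavePairFieldLROAt U δ for some δ ∈ (0,1/2).
Lean: `FatHookPairConcavity ∧ PureCooperPair ∧ DiluteBECBridge`

## Assembly
Pure logic (term proof checked sorry-free in the planner's Sketch.lean): PureCooperPair supplies U ∈
[2,8] and the Cooper-pair data (ε, z,
k₀); DiluteBECBridge at that U returns δ ∈ (0,1/2) with HasDWavePairFieldLROAt U δ, which is
definitionally the body of
Literature.Hubbard.DWaveSuperconductivityHubbard, and 0 < 2 ≤ U closes HubbardSuperconductivity.
FatHookPairConcavity is carried as the FIRST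
hypothesis deliberately (D-0019 thin open, as in PairBosonDome): it is the anchor of this route's
intended proof of PureCooperPair — the
first child of its foreseen split — not a decoration; refuters please read the Two-layer plan before
flagging it as non-load-bearing.

Rationale: WHY THIS LINE. Dirac wrote exchange as a permutation; the card adds ONE generator class — the site
parities (−1)^{n_x}, which ARE the Hubbard U (U·Σ(n↑−½)(n↓−½)
= (U/4)·Σ_x π(r_x), the class sum of reflections of B_M = Z₂≀S_M) — and observes that the whole
strong-coupling expansion (T₀ = −tΣ(π(ρ_E) −
π(ρ_E)⁻¹)/2i with ρ_E the signed transposition, support DoublonHoppingCubic; every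
Harris–Lange/MacDonald–Girvin–Yoshioka order by wreath
Schur–Weyl–Sergeev duality, doi:10.1103/PhysRevB.37.9753, doi:10.1016/0021-8693(86)90117-1) is one
element of C[Z₂≀S_M] evaluated in
bipartition irreps ((N_h),(2^p,1^q)), while the supersymmetric t-J point J = 2t is EXACTLY t times
the interchange Laplacian of the
probabilists (Sarkar doi:10.1088/0305-4470/24/5/026, Essler–Korepin doi:10.1103/physrevb.46.9147;
checked here to machine zero on 7 graphs).
Imported area: spectral theory of the interchange process ACROSS IRREPS —
Caputo–Liggett–Richthammer's proof of Aldous' conjecture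
(arXiv:0906.1238), the Alon–Kozma order on Young diagrams (arXiv:1003.1710), wreath-product gaps
(Levhari–Puder arXiv:2605.22101) — plus
S_M representation theory (contents, Pieri families, branching), which gives an exactly solvable
interacting anchor at every doping (K_M:
binding ≡ −2t, doped Lieb–Mattis gap 2(S+1)t; support CompleteGraphAnchor, verified n = 4,5,6). What
the line does that prior routes do
not: CooperPairDMottWalk walks to the same junction PureCooperPair from the plaquette (breathing)
corner by continuation in geometry; this
route descends to it from a Markov-generator corner (J = 2t) inside one finite-dimensional
*-algebra, where cross-sector statements are
order relations with exact inter-sector structure — an alternative decomposition of the shared node,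
not a rival family. Planner's
correction to the card: its finite-density concavity (C2)/(C3) is dropped — in a nodal d-wave phase
the odd–even staircase is O(v_Δ/L), so
a uniform ε > 0 at finite doping would fail exactly in the target phase; the zero-density (two holes
on the half-filled background) form is
filed instead and the finite density is delegated to the BEC bridge.

RANKED CRUXES. #2 FatHookPairConcavity (crux) — (card D5/D6, zero-density form) ∃ ε > 0, L₀ such
that for every even L ≥ L₀, on the Gutzwiller space of the torus (ℤ/Lℤ)² the sector minima λ(N,M) of
the fermionic interchange Laplacian ℒ = Σ_⟨xy⟩(1 − π(xy)) (π(xy) = Π_σ[1 −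
(c†_{xσ}−c†_{yσ})(c_{xσ}−c_{yσ})], the graded site swap) over the (N, S^z=M) ∩ no-doublon sectors
satisfy λ(L²−2,0) + λ(L²,0) + ε ≤ 2λ(L²−1,½). Equivalently (SusyInterchangeIdentity): the
supersymmetric t-J torus (J = 2t) binds two doped holes with binding energy ≤ −εt uniformly in L;
equivalently (Sergeev duality + definition request AldousLambdaOne): strict midpoint concavity of
Aldous' λ₁(A_torus;·) along the Pieri families (0;(2^{L²/2})) ◁ (1;(2^{L²/2−1},1)) ◁
(2;(2^{L²/2−1})). Intended engines: irrep-projected (central-idempotent) octopus/comparison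
inequalities for the lower bound on the one-hole family; branching S_M↓S_{M−1} ('a vacancy is an
infinitely heavy hole'); a Pieri-adapted nearest-neighbour singlet-pair trial vector for the upper
bound on the two-hole family. [difficulty: XL] (why it might fail: No irrep-sensitive lower-bound
technology exists: CLR/octopus/comparison see only near-trivial irreps ('not easy to prove any
entry', 1003.1710 §1); needs the ONE-hole energy from below to O(1) inside a gapless
antiferromagnet. Physically safe (ED: two holes bind at J=2t).) [arXiv:1003.1710, arXiv:0906.1238,
doi:10.1103/RevModPhys.66.763, doi:10.1103/physrevb.39.7074, doi:10.1088/0305-4470/24/5/026,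
doi:10.1103/physrevb.46.9147, arXiv:2605.22101]
#3 PureCooperPair (crux) — (shared verbatim with CooperPairDMottWalk.PureCooperPair; here the
endpoint of the descent J: 2t → t/2 → Hubbard U = 8) for some U ∈ [2,8], uniformly in L = 4k+4: (a)
two-hole pair binding E(L²−2, S^z=0) + E(L², 0) + ε ≤ 2E(L²−1, ½) for hubbardTorus 2 L 1 U; (b)
unique ground state of the (L²−2, 0) sector; (c) macroscopic d_{x²−y²} pair amplitude |⟨ψ₂, Δ_d
ψ₀⟩|² ≥ zL²‖ψ₀‖²‖ψ₂‖² against the Lieb-unique half-filled ground state. In this route's language: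
(a) is FatHookPairConcavity transported along J and through the Schrieffer–Wolff conjugation (every
order of which is an element of C[Z₂≀S_M]), (b) is simplicity of λ₁ in the two-hole family, (c) is a
Wigner–Eckart statement — the d-wave bond form factor has zero row sums, hence is a pure S^{(M−2,2)}
tensor operator between the half-filled and two-hole irreps. [deps: FatHookPairConcavity]
[difficulty: open-problem] (why it might fail: The descent J:2t→t/2 must keep the two-hole level
isolated while binding shrinks from O(t) to ≈0.05t (32 sites, J/t=0.3; may vanish as L→∞,
cond-mat/9806018 §3.2); the SW transfer at U=8 (t/U=1/8) is uncontrolled for the doped SU(2) model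
(StrongCouplingCeiling).) [arXiv:0803.0933, doi:10.1103/physrevb.58.13594,
doi:10.1103/PhysRevB.42.6877, doi:10.1103/PhysRevB.37.9753, DattaFernandezFrohlich1999]
#4 DiluteBECBridge (crux) — (shared verbatim with CooperPairDMottWalk.DiluteBECBridge; content of
card dilute-pair-bec-bridge) for every U ∈ [2,8], a pure-model Cooper pair in the sense (a)(b)(c)
uniformly in L = 4k+4 implies Literature.Barriers.HubbardSuperconductivity.HasDWavePairFieldLROAt U
δ for some δ ∈ (0,1/2) — bound, dilute, zero-momentum d-wave hole pairs Bose-condense at small hole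
density (low-density reduction to a hard-core d-boson gas on the antiferromagnetic background +
ground-state BEC of the dilute 2D lattice Bose gas). In this route's language the pair gas lives in
the Pieri families ((N_h),(2^{(M−N_h)/2})) and phase separation is macroscopic concavity of λ₁ in
the first-row length, which does not hurt the liminf (Maxwell mixture keeps a superfluid fraction) —
pair crystals with a charge gap do. [deps: PureCooperPair] [difficulty: open-problem] (why it might
fail: T=0 BEC of the dilute 2D hard-core lattice Bose gas is open off the half-filled RP point
(KLS1988PRL, AizenmanEtAl2004); hole/pair crystals with a charge gap or (π,π)-momentum pairs give
the staircase without zero-momentum d-wave LRO; asked ∀U∈[2,8] from two-hole data only.)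
[KLS1988PRL, AizenmanEtAl2004, LiebYngvason2001, arXiv:1701.00054, QinEtAl2020,
ArovasBergKivelsonRaghu2022]
#5 FatHookSpinOrder (crux) — (card C1, DOPED LIEB–MATTIS AT THE SUPERSYMMETRIC POINT; the
dictionary's 'moving a box from column 2 to column 1 of β raises λ₁') ∃ L₀ such that for every even
L ≥ L₀ and every electron number 2 ≤ N ≤ L², the Gutzwiller sector minima λ(N,M) of the interchange
Laplacian on the torus are STRICTLY increasing in the magnetisation along M = N/2 − k, k = 1, 2, …,
M ≥ 0: λ(N,M) < λ(N,M+1). Non-strict monotonicity is automatic (SU(2) lowering); strictness says the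
ground state of every (N,S^z=M) sector has total spin exactly |M| — the SUSY t-J torus is never
ferro- or ferrimagnetic in any hole sector, and E(S) < E(S+1) at every doping. N = L² is
Lieb–Mattis' theorem (Heisenberg antiferromagnet on the even torus); K_M is CompleteGraphAnchor (gap
2(S+1)); everything in between is new. Calibration crux for the transplanted order theory
(Alon–Kozma's star-graph 'counterexample to dominance' [2,2,1^{n−4}] vs [2,1^{n−2}] is Lieb–Mattis
ferrimagnetism of the star; here the graph is the bipartite balanced torus). [difficulty: L] (why it
might fail: Conjectural between N=L² (Lieb–Mattis) and K_M; the dilute-electron end sits AT the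
two-electron binding threshold J_c=2t (Kagan–Rice) and small-δ phase separation at J=2t
(Emery–Kivelson–Lin, Hellberg–Manousakis) may reorder spins; no Marshall sign off half filling.)
[doi:10.1063/1.1724276, arXiv:1003.1710, doi:10.1088/0953-8984/6/20/016,
doi:10.1103/PhysRevLett.64.475, doi:10.1103/PhysRevLett.78.4609, doi:10.1103/physrevb.39.7074]
#9 SusyInterchangeIdentity (support) — (card D5; provable now — a bond-local identity on the
9-dimensional two-site Gutzwiller space, then summed; verified here to machine zero on triangle,
4-cycle, K₄, K₅, 5-cycle, path P₄ and the 2×3 ladder in every (N,S^z) sector) for every finite graph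
G and t: P[hamiltonian G t 0 − (t/2)·Σ_{x,y adj (ordered)} B_{xy}†B_{xy}]P = P[−(t/2)·Σ_{x,y adj}
π(xy) − t·Σ_x deg(x)(n^s_x − ½)]P, where P = gutzwillerProj, B_{xy} = c_{x↑}c_{y↓} − c_{x↓}c_{y↑}
(so the left side is the standard t-J Hamiltonian T + JΣ_⟨xy⟩(S_x·S_y − n_x n_y/4) at J = 2t), π(xy)
the graded site swap and n^s_x = n_{x↑} + n_{x↓} − 2n_{x↑}n_{x↓}. On the 4-regular torus the right
side is t·ℒ − 4t·N + const, so t-J(2t) sector energies are t·λ(N,M) − 4tN and second differences in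
N are those of λ. [difficulty: provable-now] [doi:10.1088/0305-4470/24/5/026,
doi:10.1103/physrevb.46.9147]
#9 DoublonHoppingCubic (support) — (card D2, 'T₀ is a polynomial in the signed transposition';
provable now — a 16-dimensional identity on one bond, embeddable with the jwEmbed machinery of
HubbardBondAlgebra; verified here exactly) for two distinct sites x ≠ y of any Λ, the
doublon-number-conserving part of the bond hopping, T₀ = Σ_σ [n_{xσ̄}n_{yσ̄} +
(1−n_{xσ̄})(1−n_{yσ̄})]·(c†_{xσ}c_{yσ} + c†_{yσ}c_{xσ}), equals (4h − h³)/3 where h =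
Σ_σ(c†_{xσ}c_{yσ} + h.c.) has spectrum {0,±1,±2}; i.e. T₀ = Lagrange interpolation of sin(πh/2), the
first-order term of every t/U effective Hamiltonian written inside C[Z₂≀S_M]. [difficulty:
provable-now] [doi:10.1103/PhysRevB.37.9753, DattaFernandezFrohlich1999]
#9 CompleteGraphAnchor (support) — (card D7, the solvable anchor; provable now from known
mathematics — Sergeev/Berele–Regev duality + contents of the dominant Pieri member λ_dom = (N_h+2,
2^{p−1}, 1^{2S}), or the gl(1|2) Casimir on the Gutzwiller space; verified here for n = 4,5,6 in all
19 admissible sectors, and the full K₅ (N=4,S^z=0) spectrum {8,10,12,15,20} = C(5,2) − contents of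
the Pieri set) on the complete graph K_n, n ≥ 2, for 2 ≤ N ≤ n electrons and magnetisation M = N/2 −
k ≥ 0, k ≥ 1: min over the Gutzwiller (N,M) sector of ℒ = Σ_{x<y}(1 − π(xy)) equals n(n−1)/2 −
[(n−N+1)(n−N+2)/2 − (N/2 − M − 1)² − M(N−1)]. Consequences (second differences): supersymmetric t-J
on K_n has hole PAIR BINDING ≡ −2t at every doping (N ≥ 4) and the DOPED LIEB–MATTIS gap E(S+1) −
E(S) = 2(S+1)t at every doping — the finite-density caricature (phase separation = concave first
row) that the torus cruxes refine. [difficulty: provable-now] [doi:10.1007/bf02769969,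
doi:10.1103/physrevb.40.7252, doi:10.1016/0021-8693(86)90117-1, doi:10.1016/0001-8708(87)90007-7]

TWO-LAYER PLAN. Foreseen glued splits (nothing filed now). PureCooperPair ⇐ SusyDescent →
SchriefferWolffTransfer → PureCooperPair: SusyDescent = the
two-hole Cooper pair (a)(b)(c) for the t-J torus at every J ∈ [t/2, 2t], obtained by following the
isolated two-hole level of the
general-J form of D5 — a positive-rate TYPED interchange generator plus the diagonal Feynman–Kac
potential ((2t−J)/2)·Σ_⟨xy⟩Π^s — down from
the supersymmetric anchor (FatHookPairConcavity is its J = 2t case); SchriefferWolffTransfer = t-J(J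
= 4t²/U) + three-site terms ⟹
hubbardTorus 2 L 1 U at U = 8 with the level still isolated (Datta–Fernández–Fröhlich block
diagonalisation restricted to the two-hole
sector, every order an element of C[Z₂≀S_M] by D3). FatHookPairConcavity ⇐ OneHoleFloor →
TwoHoleCeiling → FatHookPairConcavity:
OneHoleFloor = a lower bound λ(L²−1,½) ≥ λ(L²,0) + μ − η via idempotent-projected octopus/comparison
inequalities and branching S_M↓S_{M−1}
(vacancy = infinitely heavy hole, hole bandwidth ≤ 4); TwoHoleCeiling = a Pieri-adapted
nearest-neighbour singlet-pair trial bound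
λ(L²−2,0) ≤ λ(L²,0) + 2μ − 2η − ε. DiluteBECBridge splits as in CooperPairDMottWalk / card
dilute-pair-bec-bridge (low-density reduction,
DiluteBEC), shared.

KILL CRITERIA. Certified ED/DMRG showing the supersymmetric two-hole binding E(L²−2)+E(L²)−2E(L²−1)
at J = 2t tending to ≥ 0 along even tori (4×4, 6×6,
8×8 few-hole sectors) — or a proof — refutes FatHookPairConcavity: close
`refuted:FatHookPairConcavity` (the anchor is worthless, the
algebra stays as Literature). PureCooperPair refuted for all U ∈ [2,8] (shared fate with
CooperPairDMottWalk): pivot once — restate the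
endpoint on U ∈ [8,16], all even L, new decl — only if t-J numerics at J ≤ t/2 still bind on ≥ 32
sites; else close. DiluteBECBridge
refuted: the BEC side dies for both routes; close unless ParityGapRigidity.IncommensurateRigidity
supplies a replacement bridge.
FatHookSpinOrder refuted: drop it (calibration, not load-bearing) and record which (N,S) reorders —
that datum re-ranks SusyDescent.
A printed identification of doped t-J/Hubbard sector energies with Aldous' λ₁ in fat-hook irreps
only lowers novelty, not viability.

NOT DECOMPOSED YET. The J-descent and the Schrieffer–Wolff transfer (children of PureCooperPair,
above); the irrep-sensitive inequality engine K1 (children of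
FatHookPairConcavity); clauses (b),(c) of PureCooperPair in irrep language (simplicity of λ₁ in the
two-hole family; the S^{(M−2,2)}
tensor-operator selection rule for Δ_d); the general-J typed-interchange + Feynman–Kac form of D5
and the doublon sectors / the full
element (U/4)Σπ(r_x) + tκ₁ + (t²/U)κ₂ of C[Z₂≀S_M] (definition requests filed instead of items);
every constant (ε(J), pair size, L₀).

CHEAPEST FALSIFIER. Lanczos on the 4×4 torus (and 6×6 with ≤ 2 holes) of the t-J model at J = 2t —
equivalently of ℒ on the Gutzwiller sectors: (i)
E(14,0)+E(16,0)−2E(15,½) (expected ≈ −t; a value ≥ 0, or one drifting to 0 from 4×4 to 6×6, kills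
FatHookPairConcavity's premise); (ii) the
ladders λ(N,M), N = 2…16 (a tie λ(N,M) = λ(N,M+1) not explained by the 4×4 hypercube symmetry hits
FatHookSpinOrder). Not run here: kit
compute socket absent and no numpy on the hub. Run here instead (pure python, folder check_tj.py →
check_tj.out): SusyInterchangeIdentity
exact (max deviation 0.0) on 7 graphs in every sector; CompleteGraphAnchor exact for n = 4,5,6 (19
sectors) and the full K₅ (4,0) spectrum
{8,10,12,15,20}; DoublonHoppingCubic exact, spectrum of h = {0,±1,±2}.

NUMBERS. K_M anchor: binding ≡ −2t (N_e ≥ 4), doped Lieb–Mattis gap 2(S+1)t (p ≥ 2), λ₁ formula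
above (n = 4,5,6 verified). Square lattice t-J:
two holes bind on 4×4 for J/t ≳ 0.1 and |Δ_B| grows with J (Bonča–Prelovšek–Sega
doi:10.1103/physrevb.39.7074; Dagotto
doi:10.1103/RevModPhys.66.763 §IV); E_b ≈ −0.05t at J/t = 0.3 on 32 sites
(doi:10.1103/physrevb.58.13594); two-ELECTRON bound-state
threshold exactly J_c = 2t (Kagan–Rice doi:10.1088/0953-8984/6/20/016); phase separation at n → 0
for J/t ≳ 3.4 and contested for small δ
at J = 2t (doi:10.1103/PhysRevLett.64.475, doi:10.1103/PhysRevLett.78.4609). Pure Hubbard 4×4: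
two-hole binding weak and boundary-condition
sensitive (doi:10.1103/PhysRevB.42.6877, arXiv:0803.0933). U = 8 ↔ J = 4t²/U = t/2. Items at open: 8
(4 cruxes, 3 supports, 1 assembly).

DEFINITION REQUESTS. (filed right after open) D1 AldousLambdaOne — for a finite weighted graph A on
n vertices and a partition λ ⊢ n, λ₁(A;λ) := the smallest
eigenvalue of Σ_{x<y} a_{xy}(1 − ρ_λ((xy))) (Alon–Kozma arXiv:1003.1710 eq. (1)); topic
Literature/RepresentationTheory/FiniteGroups (isotypic
projectors exist there). D2 GradedHyperoctahedralFockAction — the unitary representation π of Z₂≀S_n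
on Fock (Orb Λ), |Λ| = n, with
π((xy)) = the graded site swap Sw x y of the cruxes and π(r_x) = (−1)^{n_x}; topic
Literature/MathematicalPhysics/QuantumLattice. Cite fact
wanted: wreath Schur–Weyl–Sergeev duality on (ℂ^{2|2})^{⊗n} — π(C[Z₂≀S_n]) and gl(2)_charge ⊕
gl(2)_spin are mutual commutants; the
Gutzwiller (N_h holes, spin S) sector is the Pieri sum ⊕ S^λ, λ/(2^{(n−N_h)/2−S},1^{2S}) a
horizontal N_h-strip (Sergeev 1984;
Berele–Regev doi:10.1016/0001-8708(87)90007-7; Regev doi:10.1016/0021-8693(86)90117-1). With D1 +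
the fact, FatHookPairConcavity is
literally 'λ₁(A_torus;·) strictly midpoint-concave along three Pieri families'.

Novelty: Searches (2026-08-15; local searchd resetting connections all session, remote sources used): `lit
search --source zbmath "interchange
process spectral gap irreducible representations symmetric group Aldous"` (1: Alon–Kozma
doi:10.4153/cmb-2011-147-2); `lit search --source
crossref "Hubbard model complete graph exact solution"` (8; Salerno doi:10.1007/bf02769969,
Stefanucci–Cini doi:10.1103/physrevb.66.115108);
`… "t-J model complete graph infinite range hopping exact ground state"` (10; van Dongen–Vollhardt
doi:10.1103/physrevb.40.7252, Vergés et
al. doi:10.1103/physrevb.49.15400); `… "bound state two electrons t-J model low density"` (8;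
Kagan–Rice doi:10.1088/0953-8984/6/20/016);
`… "binding of holes t-J model exact diagonalization two holes d-wave"` (10; Bonča–Prelovšek–Sega
doi:10.1103/physrevb.39.7074); `lit
galaxy search --star all` for "interchange process" (10+10 substring rows, none
mathematical-physics), "supersymmetric t-J model" (9+9: 1D
integrability books/papers only — Essler–Frahm–Göhmann–Klümper–Korepin, Kuramoto–Kato, gl(m|n) Bethe
vectors), "binding of two holes"
(1+1, unrelated); `lit frontier HubbardSuperconductivity --since 2020` (30 rows; nearest
arXiv:2601.18868 on Cooper condensation, native
language); `lit bridges HubbardSuperconductivity --cross any` (30 rows, none via S_n spectral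
theory); `lit read arxiv:1003.1710` pp. 3–4,
11 (Aldous order, CLR theorem, Bacher hooks, star/cycle counterexamples); grep of all 43 Theses of
the sub-problem for
hyperoc  [refs: 10.4153/cmb-2011-147-2, 10.1007/bf02769969, 10.1103/physrevb.66.115108, 10.1103/physrevb.40.7252, 10.1103/physrevb.49.15400, 10.1088/0953-8984/6/20/016, 10.1103/physrevb.39.7074, 10.1088/0305-4470/24/5/026, 10.1103/physrevb.46.9147, 10.1016/0021-8693(86, 2601.18868, 1003.1710, 0906.1238, 1811.10530, 2605.22101, doi:10.4153/cmb-2011-147-2, doi:10.1007/bf02769969, doi:10.1103/physrevb.66.115108, doi]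

Barriers (technique_class: interchange-process rep-theory, t-over-U eff-hamiltonian): - technique_class: interchange-process rep-theory, t-over-U eff-hamiltonian
- Literature.Barriers.HubbardSuperconductivity.StrongCouplingCeiling: NOT evaded at the
SchriefferWolffTransfer step of PureCooperPair (a t/U effective-Hamiltonian conjugation for the
doped SU(2) model, exactly the class the entry says is 'not suited'); the bet is that only the
ISOLATED TWO-HOLE LEVEL of a finite torus family must be transported, uniformly in L, not a phase
diagram or a low-temperature state — a spectral-perturbation statement in one charge sector, for
which finitely-degenerate gapped reference states are not required. FatHookPairConcavity itself has
no expansion parameter (J = 2t is not perturbative in anything) and is outside the class.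
- Literature.Barriers.HubbardSuperconductivity.SignProblemNPHard: not met and partly illuminated —
at J = 2t the t-J Hamiltonian IS t times a positive-rate Markov generator (the interchange process);
the fermion signs are absorbed into WHICH irrep is physical (fat hooks, not the trivial one), and no
sampling claim is made; ED enters only as the refuter's instrument.
- Literature.Barriers.HubbardSuperconductivity.LROForcesLowLyingStates: respected — every item is an
energy statement about fixed-(N,S^z) sector ground states of number-conserving Hamiltonians or
(DiluteBECBridge) LRO of symmetric sector ground states; no anomalous average, no uniform gap above
a unique ground state is asserted; the N±2 tower is exactly the pair-addition staircase the cru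

History (route lifecycle, newest last):
- 2026-08-15T16:17:57Z · rev 3: restated DiluteBECBridge (stmt-HubbardSuperconductivity-1178) — route-repair (cone + glue, gen 2): decision (a) RE-ROUTE AROUND. DiluteBECBridge (stmt-HubbardSuperconductivity-1178) restated to the IDENTICAL inlined term of (planner-rbadge-HubbardSuperconductivity-Hypero-dcd3130e-g2-0)
- 2026-08-24T10:03:17Z · DORMANT — reconciler: no traction for 6.7 d (last activity item-evidence-added at 2026-08-17T16:57:53Z); parked, not closed — `ledger route dormant route-HubbardSupercond (operator:999:1434847)

sub-problem: HubbardSuperconductivity · status: dormant · opened planner-plancard-HubbardSuperconductivity-Hub-86d1d386-0 2026-08-15T11:49:52Z · rev 3 · ledger route-HubbardSuperconductivity-HyperoctahedralMott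
GENERATED by the gate from the ledger (D-0016/17). Provers cite these decls: `theorem foo : Summit.HubbardSuperconductivity.HubbardSuperconductivity.Theses.HyperoctahedralMott.<Decl> := …` in Summits/HubbardSuperconductivity/HubbardSuperconductivity/Theorems/<Name>.lean.
-/

namespace Summit.HubbardSuperconductivity.HubbardSuperconductivity.Theses.HyperoctahedralMott

open scoped BigOperators Topology Manifold Classical MeasureTheory ProbabilityTheory Matrix InnerProductSpace ComplexConjugate ContinuousMap
open Filter Set Function TopologicalSpace MeasureTheory

attribute [summit_statement] _root_.HubbardSuperconductivity

open Literature.Hubbard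

/-- item stmt-HubbardSuperconductivity-6673 · crux · rank 2 · open · by planner
why it might fail: Uniform ε needs the one-hole floor λ(L²−1,½) from below to O(1) against O(L²) gapless-AFM energies; CLR/Alon–Kozma all-irrep tools reach only near-trivial shapes (1003.1710 §1). Truth rests on ED alone: E_b<0 for J/t≳0.3, 16–32 sites, erratic FSS (cond-mat/9311013 p.26); no J=2t torus series.
sources: arXiv:1003.1710, arXiv:0906.1238, doi:10.1103/RevModPhys.66.763, doi:10.1103/physrevb.39.7074, doi:10.1103/physrevb.58.13594, doi:10.1088/0305-4470/24/5/026
[crux] (card D5/D6, zero-density form) ∃ ε > 0, L₀ such that for every even L ≥ L₀, on the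
Gutzwiller space of the torus (ℤ/Lℤ)² the sector minima λ(N,M) of the fermionic interchange
Laplacian ℒ = Σ_⟨xy⟩(1 − π(xy)) (π(xy) = Π_σ[1 − (c†_{xσ}−c†_{yσ})(c_{xσ}−c_{yσ})], the graded site
swap) over the (N, S^z=M) ∩ no-doublon sectors satisfy λ(L²−2,0) + λ(L²,0) + ε ≤ 2λ(L²−1,½).
Equivalently (SusyInterchangeIdentity): the supersymmetric t-J torus (J = 2t) binds two doped holes
with binding energy ≤ −εt uniformly in L; equivalently (Sergeev duality + definition request
AldousLambdaOne): strict midpoint concavity of Aldous' λ₁(A_torus;·) along the Pieri families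
(0;(2^{L²/2})) ◁ (1;(2^{L²/2−1},1)) ◁ (2;(2^{L²/2−1})). Intended engines: irrep-projected
(central-idempotent) octopus/comparison inequalities for the lower bound on the one-hole family;
branching S_M↓S_{M−1} ('a vacancy is an infinitely heavy hole'); a Pieri-adapted nearest-neighbour
singlet-pair trial vector for the upper bound on the two-hole family. [difficulty: XL] -/
@[route_item "route-HubbardSuperconductivity-HyperoctahedralMott", crux]
def FatHookPairConcavity : Prop :=
  open Literature.MathematicalPhysics.QuantumLattice in ∃ ε > (0 : ℝ), ∃ L₀ : ℕ, ∀ (L : ℕ) [NeZero L], L₀ ≤ L → Even L → let Λ := FermionTorus 2 L; let G := fermionTorusGraph 2 L; let Sw : Λ → Λ → Matrix (Finset (Orb Λ)) (Finset (Orb Λ)) ℂ := fun x y => (1 - (creation (orb x 0) - creation (orb y 0)) * (annihilation (orb x 0) - annihilation (orb y 0))) * (1 - (creation (orb x 1) - creation (orb y 1)) * (annihilation (orb x 1) - annihilation (orb y 1))); let Lap : Matrix (Finset (Orb Λ)) (Finset (Orb Λ)) ℂ := (1 / 2 : ℂ) • ∑ x : Λ, ∑ y : Λ, (if G.Adj x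 y then (1 - Sw x y) else 0); let K : ℕ → ℝ → Submodule ℂ (Fock (Orb Λ)) := fun N M => szSector N M ⊓ Module.End.eigenspace (Matrix.toLin' (gutzwillerProj : Matrix (Finset (Orb Λ)) (Finset (Orb Λ)) ℂ)) 1; let lam : ℕ → ℝ → ℝ := fun N M => Lap.minEnergyOn (K N M); lam (L ^ 2 - 2) 0 + lam (L ^ 2) 0 + ε ≤ 2 * lam (L ^ 2 - 1) (1 / 2)

/-- item stmt-HubbardSuperconductivity-1175 · crux · rank 3 · open · by planner
why it might fail: May be false ∀U≤8: 4×4 Hubbard Δ_B small, BC-sensitive — 'no convincing evidence of hole binding near half filling in the bulk' (cond-mat/9311013 p.27; PRB42 6877; 0803.0933 p.7); t-J binding at J=t/2↔U=8 shrinks 16→32 sites (PRB58 13594 §3.2); J-descent 2t→t/2 + SW at t/U=1/8 uncontrolled.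
sources: arXiv:0803.0933, doi:10.1103/physrevb.58.13594, doi:10.1103/PhysRevB.42.6877, doi:10.1103/RevModPhys.66.763, doi:10.1103/physrevb.65.205101, doi:10.1103/PhysRevB.37.9753
[target] X = hypothesis (P) for the PURE model (t=1, t'=0): for some U in [2,8], uniformly in L =
4k+4: (a) two-hole pair binding E(L^2-2,S^z=0) + E(L^2,0) + eps <= 2 E(L^2-1,1/2), eps>0 (the
cluster literature's Delta_pb = 2E(M)-E(M+1)-E(M-1) at M = 1 hole, arXiv:0803.0933 eq. (2)); (b)
unique ground state of the (L^2-2, S^z=0) sector; (c) macroscopic d_{x^2-y^2} pair amplitude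
|<psi_2, Delta_d psi_0>|^2 >= z L^2 |psi_0|^2 |psi_2|^2 against the Lieb-unique half-filled GS
(equivalently: psi_2 is a K=0 singlet, B1g relative to psi_0, with nonzero n.n. d-wave weight). This
is the walk's endpoint (conclusion of BindingWalk) and the hypothesis of DiluteBECBridge; claimable
directly (certified ED on 4x4/sqrt20/sqrt32 tori decides its fate fast; a large-U/t-J-corner proof
would also close it). Shared in content with card dilute-pair-bec-bridge's (P). Sources:
arXiv:0803.0933, doi:10.1103/physrevb.58.13594, doi:10.1103/PhysRevB.42.6877, LiebPRL1989. -/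
@[route_item "route-HubbardSuperconductivity-HyperoctahedralMott", crux]
def PureCooperPair : Prop :=
  open Literature.MathematicalPhysics.QuantumLattice in let CP := fun (L : ℕ) [NeZero L] (H : Matrix (Finset (Orb (FermionTorus 2 L))) (Finset (Orb (FermionTorus 2 L))) ℂ) (ε z : ℝ) => H.minEnergyOn (szSector (L ^ 2 - 2) 0) + H.minEnergyOn (szSector (L ^ 2) 0) + ε ≤ 2 * H.minEnergyOn (szSector (L ^ 2 - 1) (1 / 2)) ∧ (∀ φ₁ φ₂, IsGroundStateInSector H (L ^ 2 - 2) 0 φ₁ → IsGroundStateInSector H (L ^ 2 - 2) 0 φ₂ → ∃ c : ℂ, φ₂ = c • φ₁) ∧ (∀ φ₀ φ₂, IsGroundStateInSector H (L ^ 2) 0 φ₀ → IsGroundStateInSector H (L ^ 2 - 2) 0 φ₂ → z * (L : ℝ) ^ 2 * (star φ₀ ⬝ᵥ φ₀).re * (star φ₂ ⬝ᵥ φ₂).re ≤ ‖star φ₂ ⬝ᵥ (pairField dWaveFormFactor L *ᵥ φ₀)‖ ^ 2); ∃ U ∈ Set.Icc (2 : ℝ) 8, ∃ ε > (0 : ℝ),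 ∃ z > (0 : ℝ), ∃ k₀ : ℕ, ∀ k ≥ k₀, CP (4 * k + 4) (hubbardTorus 2 (4 * k + 4) 1 U) ε z

-- earlier DiluteBECBridge (stmt-HubbardSuperconductivity-1178, replaced 2026-08-15T16:17:57Z -> stmt-HubbardSuperconductivity-10314): retired by None — open Literature.MathematicalPhysics.QuantumLattice in let CP := fun (L : ℕ) [NeZero L] (H : Matrix (Finset (Orb (FermionTorus 2 L))) (Finset (Orb (FermionTorus 2 L))) ℂ) (ε z : ℝ) => H.minEnergyOn (szSector (L ^ 2 - 2) 0) + H.minEnergyOn (szSector (L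
/-- item stmt-HubbardSuperconductivity-10314 · crux · rank 4 · open · by planner
why it might fail: ∀U∈[2,8] from 2-hole data only: hole crystals / λ=8 filled stripes with a pair charge gap may persist as δ→0⁺ (win at δ=1/8, U=6–12, t′=0: 1701.00054 p.6; QinEtAl2020 §IV); (π,π) pairs give the staircase without k=0 d-wave LRO; T=0 BEC of dilute 2D hard-core lattice bosons open off the RP point.
sources: arXiv:1701.00054, QinEtAl2020, ArovasBergKivelsonRaghu2022, KLS1988PRL, AizenmanEtAl2004, LiebYngvason2001
[crux] X -> S, the BEC-side bridge: for every U in [2,8], a pure-model Cooper pair in the sense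
(a)(b)(c) (uniform in L=4k+4) implies d_{x^2-y^2} pair-field LRO of EVERY (N_L, S^z=0)-sector
ground-state sequence at some hole doping delta in (0,1/2), i.e. the summit's body at fixed (U,
delta) WRITTEN OUT VERBATIM (N_L = 2*floor((1-delta)L^2/2), normalised IsGroundStateInSector
sequences of hubbardTorus 2 L 1 U, HasLongRangeOrder of torusPullback (pairFieldCorr dWaveFormFactor
psi) (2k) over halfOpenBox 2 (2k)) — definitionally the former conclusion
Literature.Barriers.HubbardSuperconductivity.HasDWavePairFieldLROAt U delta (Iff.rfl); inlined by
route-repair 2026-08-15 so that the route file no longer imports the Barriers module that carries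
the registered open conjectures PureModelStripeCompetition / PureModelStripeCompetitionRange (never
hypotheses of this route). Content = (R) low-density reduction: at hole-pair density delta/2 <<
1/xi_p^2 the sector ground states are those of a dilute gas of hard-core d-bosons on the
antiferromagnetic background, with pair field = sqrt(Z_d) L (boson zero mode) + remainder, Z_d > 0
being exactly clause (c); and (B) DiluteBEC: ground-state ODLRO n_ -/
@[route_item "route-HubbardSuperconductivity-HyperoctahedralMott", crux]
def DiluteBECBridge : Prop :=
  open Literature.MathematicalPhysics.QuantumLattice in let CP := fun (L : ℕ) [NeZero L] (H : Matrix (Finset (Orb (FermionTorus 2 L))) (Finset (Orb (FermionTorus 2 L))) ℂ) (ε z : ℝ) => H.minEnergyOn (szSector (L ^ 2 - 2) 0) + H.minEnergyOn (szSector (L ^ 2) 0) + ε ≤ 2 * H.minEnergyOn (szSector (L ^ 2 - 1) (1 / 2)) ∧ (∀ φ₁ φ₂, IsGroundStateInSector H (L ^ 2 - 2) 0 φ₁ → IsGroundStateInSector H (L ^ 2 - 2) 0 φ₂ → ∃ c : ℂ, φ₂ = c • φ₁) ∧ (∀ φ₀ φ₂, IsGroundStateInSector H (L ^ 2) 0 φ₀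 → IsGroundStateInSector H (L ^ 2 - 2) 0 φ₂ → z * (L : ℝ) ^ 2 * (star φ₀ ⬝ᵥ φ₀).re * (star φ₂ ⬝ᵥ φ₂).re ≤ ‖star φ₂ ⬝ᵥ (pairField dWaveFormFactor L *ᵥ φ₀)‖ ^ 2); ∀ U ∈ Set.Icc (2 : ℝ) 8, (∃ ε > (0 : ℝ), ∃ z > (0 : ℝ), ∃ k₀ : ℕ, ∀ k ≥ k₀, CP (4 * k + 4) (hubbardTorus 2 (4 * k + 4) 1 U) ε z) → ∃ δ ∈ Set.Ioo (0 : ℝ) (1 / 2), ∀ (N : ℕ → ℕ) (ψ : ∀ L, Fock (Orb (FermionTorus 2 L))), (∀ L, Even L → N L = 2 * ⌊(1 - δ) * (L : ℝ) ^ 2 / 2⌋₊ ∧ star (ψ L) ⬝ᵥ ψ L = 1 ∧ IsGroundStateInSector (hubbardTorus 2 L 1 U) (N L) 0 (ψ L)) → Literature.Probability.LatticeModels.HasLongRangeOrder (fun k => Literature.Probability.LatticeModels.halfOpenBox 2 (2 * k)) (fun k => torusPullback (pairFieldCorr dWaveFormFactor ψ) (2 * k))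

/-- item stmt-HubbardSuperconductivity-6674 · crux · rank 5 · open · by planner
why it might fail: At J=2t holes cluster near n=1 (PRL 64 475; PRL 78 4609): a hole cluster with sublattice imbalance leaves a punctured AFM that Lieb–Mattis makes ferrimagnetic (S>|M|), so strictness can break at some N<L²; the dilute end sits exactly at the pair threshold J_c=2t (cond-mat/9311013 p.55).
sources: doi:10.1063/1.1724276, Literature.MathematicalPhysics.QuantumLattice.lieb_mattis_monotone, doi:10.1103/PhysRevLett.64.475, doi:10.1103/PhysRevLett.78.4609, doi:10.1103/RevModPhys.66.763, doi:10.1088/0953-8984/6/20/016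
[crux] (card C1, DOPED LIEB–MATTIS AT THE SUPERSYMMETRIC POINT; the dictionary's 'moving a box from
column 2 to column 1 of β raises λ₁') ∃ L₀ such that for every even L ≥ L₀ and every electron number
2 ≤ N ≤ L², the Gutzwiller sector minima λ(N,M) of the interchange Laplacian on the torus are
STRICTLY increasing in the magnetisation along M = N/2 − k, k = 1, 2, …, M ≥ 0: λ(N,M) < λ(N,M+1).
Non-strict monotonicity is automatic (SU(2) lowering); strictness says the ground state of every
(N,S^z=M) sector has total spin exactly |M| — the SUSY t-J torus is never ferro- or ferrimagnetic in
any hole sector, and E(S) < E(S+1) at every doping. N = L² is Lieb–Mattis' theorem (Heisenberg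
antiferromagnet on the even torus); K_M is CompleteGraphAnchor (gap 2(S+1)); everything in between
is new. Calibration crux for the transplanted order theory (Alon–Kozma's star-graph 'counterexample
to dominance' [2,2,1^{n−4}] vs [2,1^{n−2}] is Lieb–Mattis ferrimagnetism of the star; here the graph
is the bipartite balanced torus). [difficulty: L] -/
@[route_item "route-HubbardSuperconductivity-HyperoctahedralMott"]
def FatHookSpinOrder : Prop :=
  open Literature.MathematicalPhysics.QuantumLattice in ∃ L₀ : ℕ, ∀ (L : ℕ) [NeZero L], L₀ ≤ L → Even L → let Λ := FermionTorus 2 L; let G := fermionTorusGraph 2 L; let Sw : Λ → Λ → Matrix (Finset (Orb Λ)) (Finset (Orb Λ)) ℂ := fun x y => (1 - (creation (orb x 0) - creation (orb y 0)) * (annihilation (orb x 0) - annihilation (orb y 0))) * (1 - (creation (orb x 1) - creation (orb y 1)) * (annihilation (orb x 1) - annihilation (orb y 1))); let Lap : Matrix (Finset (Orb Λ)) (Finset (Orb Λ)) ℂ := (1 / 2 : ℂ) • ∑ x : Λ, ∑ y : Λ, (if G.Adj x y then (1 - Sw x y) else 0); let K : ℕ → ℝ → Submodule ℂ (Fock (Orb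 Λ)) := fun N M => szSector N M ⊓ Module.End.eigenspace (Matrix.toLin' (gutzwillerProj : Matrix (Finset (Orb Λ)) (Finset (Orb Λ)) ℂ)) 1; let lam : ℕ → ℝ → ℝ := fun N M => Lap.minEnergyOn (K N M); ∀ (N : ℕ) (M : ℝ), N ≤ L ^ 2 → 0 ≤ M → M + 1 ≤ (N : ℝ) / 2 → (∃ k : ℤ, M = (N : ℝ) / 2 - k) → lam N M < lam N (M + 1)

/-- item stmt-HubbardSuperconductivity-6675 · support · rank 9 · closed · proved by Summit.HubbardSuperconductivity.HubbardSuperconductivity.Theorems.HyperoctahedralMott.susyInterchangeIdentity_proof @ df74b65ad2fb (prover) · by planner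
sources: doi:10.1088/0305-4470/24/5/026, doi:10.1103/physrevb.46.9147
[support] (card D5; provable now — a bond-local identity on the 9-dimensional two-site Gutzwiller
space, then summed; verified here to machine zero on triangle, 4-cycle, K₄, K₅, 5-cycle, path P₄ and
the 2×3 ladder in every (N,S^z) sector) for every finite graph G and t: P[hamiltonian G t 0 −
(t/2)·Σ_{x,y adj (ordered)} B_{xy}†B_{xy}]P = P[−(t/2)·Σ_{x,y adj} π(xy) − t·Σ_x deg(x)(n^s_x −
½)]P, where P = gutzwillerProj, B_{xy} = c_{x↑}c_{y↓} − c_{x↓}c_{y↑} (so the left side is the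
standard t-J Hamiltonian T + JΣ_⟨xy⟩(S_x·S_y − n_x n_y/4) at J = 2t), π(xy) the graded site swap and
n^s_x = n_{x↑} + n_{x↓} − 2n_{x↑}n_{x↓}. On the 4-regular torus the right side is t·ℒ − 4t·N +
const, so t-J(2t) sector energies are t·λ(N,M) − 4tN and second differences in N are those of λ.
[difficulty: provable-now] -/
@[route_item "route-HubbardSuperconductivity-HyperoctahedralMott"]
def SusyInterchangeIdentity : Prop :=
  open Literature.MathematicalPhysics.QuantumLattice in ∀ (Λ : Type) [LinearOrder Λ] [Fintype Λ] (G : SimpleGraph Λ) [DecidableRel G.Adj] (t : ℝ), let Sw : Λ → Λ → Matrix (Finset (Orb Λ)) (Finset (Orb Λ)) ℂ := fun x y => (1 - (creation (orb x 0) - creation (orb y 0)) * (annihilation (orb x 0) - annihilation (orb y 0))) * (1 - (creation (orb x 1) - creation (orb y 1)) * (annihilation (orb x 1) - annihilation (orb y 1))); let B : Λ → Λ → Matrix (Finset (Orb Λ)) (Finset (Orb Λ)) ℂ := fun x y => annihilation (orb x 0) * annihilation (orb y 1) - annihilation (orb x 1) * annihilation (orb y 0); let nS : Λ → Matrix (Finset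 (Orb Λ)) (Finset (Orb Λ)) ℂ := fun x => numberOp x 0 + numberOp x 1 - (2 : ℂ) • (numberOp x 0 * numberOp x 1); let P : Matrix (Finset (Orb Λ)) (Finset (Orb Λ)) ℂ := gutzwillerProj; P * (hamiltonian G t 0 - ((t / 2 : ℝ) : ℂ) • ∑ x : Λ, ∑ y : Λ, (if G.Adj x y then (B x y)ᴴ * B x y else 0)) * P = P * (-(((t / 2 : ℝ) : ℂ) • ∑ x : Λ, ∑ y : Λ, (if G.Adj x y then Sw x y else 0)) - (t : ℂ) • ∑ x : Λ, ((G.degree x : ℕ) : ℂ) • (nS x - (1 / 2 : ℂ) • (1 : Matrix (Finset (Orb Λ)) (Finset (Orb Λ)) ℂ))) * P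

/-- item stmt-HubbardSuperconductivity-6676 · support · rank 9 · closed · proved by Summit.HubbardSuperconductivity.HubbardSuperconductivity.Theorems.HyperoctahedralMott.doublonHoppingCubic_proof (prover) · by planner
sources: doi:10.1103/PhysRevB.37.9753, DattaFernandezFrohlich1999
[support] (card D2, 'T₀ is a polynomial in the signed transposition'; provable now — a
16-dimensional identity on one bond, embeddable with the jwEmbed machinery of HubbardBondAlgebra;
verified here exactly) for two distinct sites x ≠ y of any Λ, the doublon-number-conserving part of
the bond hopping, T₀ = Σ_σ [n_{xσ̄}n_{yσ̄} + (1−n_{xσ̄})(1−n_{yσ̄})]·(c†_{xσ}c_{yσ} +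
c†_{yσ}c_{xσ}), equals (4h − h³)/3 where h = Σ_σ(c†_{xσ}c_{yσ} + h.c.) has spectrum {0,±1,±2}; i.e.
T₀ = Lagrange interpolation of sin(πh/2), the first-order term of every t/U effective Hamiltonian
written inside C[Z₂≀S_M]. [difficulty: provable-now] -/
@[route_item "route-HubbardSuperconductivity-HyperoctahedralMott"]
def DoublonHoppingCubic : Prop :=
  open Literature.MathematicalPhysics.QuantumLattice in ∀ (Λ : Type) [LinearOrder Λ] [Fintype Λ] (x y : Λ), x ≠ y → let h : Matrix (Finset (Orb Λ)) (Finset (Orb Λ)) ℂ := ∑ σ : Fin 2, (creation (orb x σ) * annihilation (orb y σ) + creation (orb y σ) * annihilation (orb x σ)); let T0 : Matrix (Finset (Orb Λ)) (Finset (Orb Λ)) ℂ := ∑ σ : Fin 2, (numberOp x (1 - σ) * numberOp y (1 - σ) + (1 - numberOp x (1 - σ)) * (1 - numberOp y (1 - σ))) * (creation (orb x σ) * annihilation (orb y σ) + creation (orb y σ) * annihilation (orb x σ)); T0 = (1 / 3 : ℂ) • ((4 : ℂ) • h - h * h * h)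

/-- item stmt-HubbardSuperconductivity-6677 · support · rank 9 · closed · proved by Summit.HubbardSuperconductivity.HubbardSuperconductivity.Theorems.HyperoctahedralMott.completeGraphAnchor_proof @ a5e42e83e772 (prover) · by planner
sources: doi:10.1007/bf02769969, doi:10.1103/physrevb.40.7252, doi:10.1016/0021-8693(86)90117-1, doi:10.1016/0001-8708(87)90007-7
[support] (card D7, the solvable anchor; provable now from known mathematics — Sergeev/Berele–Regev
duality + contents of the dominant Pieri member λ_dom = (N_h+2, 2^{p−1}, 1^{2S}), or the gl(1|2)
Casimir on the Gutzwiller space; verified here for n = 4,5,6 in all 19 admissible sectors, and the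
full K₅ (N=4,S^z=0) spectrum {8,10,12,15,20} = C(5,2) − contents of the Pieri set) on the complete
graph K_n, n ≥ 2, for 2 ≤ N ≤ n electrons and magnetisation M = N/2 − k ≥ 0, k ≥ 1: min over the
Gutzwiller (N,M) sector of ℒ = Σ_{x<y}(1 − π(xy)) equals n(n−1)/2 − [(n−N+1)(n−N+2)/2 − (N/2 − M −
1)² − M(N−1)]. Consequences (second differences): supersymmetric t-J on K_n has hole PAIR BINDING ≡
−2t at every doping (N ≥ 4) and the DOPED LIEB–MATTIS gap E(S+1) − E(S) = 2(S+1)t at every doping —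
the finite-density caricature (phase separation = concave first row) that the torus cruxes refine.
[difficulty: provable-now] -/
@[route_item "route-HubbardSuperconductivity-HyperoctahedralMott"]
def CompleteGraphAnchor : Prop :=
  open Literature.MathematicalPhysics.QuantumLattice in ∀ (n : ℕ), 2 ≤ n → let Λ := Fin n; let G : SimpleGraph Λ := ⊤; let Sw : Λ → Λ → Matrix (Finset (Orb Λ)) (Finset (Orb Λ)) ℂ := fun x y => (1 - (creation (orb x 0) - creation (orb y 0)) * (annihilation (orb x 0) - annihilation (orb y 0))) * (1 - (creation (orb x 1) - creation (orb y 1)) * (annihilation (orb x 1) - annihilation (orb y 1))); let Lap : Matrix (Finset (Orb Λ)) (Finset (Orb Λ)) ℂ := (1 / 2 : ℂ) • ∑ x : Λ, ∑ y : Λ, (if G.Adj x y then (1 - Sw x y) else 0); let K : ℕ → ℝ → Submodule ℂ (Fock (Orb Λ)) := fun N M => szSector N M ⊓ Module.End.eigenspace (Matrix.toLin' (gutzwillerProj : Matrix (Finset (Orb Λ)) (Finset (Orb Λ)) ℂ)) 1; ∀ (N : ℕ) (M : ℝ), N ≤ n → 0 ≤ M → M + 1 ≤ (N : ℝ) / 2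 → (∃ k : ℤ, M = (N : ℝ) / 2 - k) → Lap.minEnergyOn (K N M) = (n : ℝ) * ((n : ℝ) - 1) / 2 - (((n : ℝ) - N + 1) * ((n : ℝ) - N + 2) / 2 - ((N : ℝ) / 2 - M - 1) ^ 2 - M * ((N : ℝ) - 1))

/-- item stmt-HubbardSuperconductivity-6678 · assembly · rank 1 · closed · proved by Summit.HubbardSuperconductivity.HubbardSuperconductivity.Theorems.hyperoctahedralMott_assembly_proof (prover) · by planner
sources: ArovasBergKivelsonRaghu2022, Scalapino1995
[assembly] FatHookPairConcavity → PureCooperPair → DiluteBECBridge → HubbardSuperconductivity. -/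
@[route_item "route-HubbardSuperconductivity-HyperoctahedralMott"]
def Assembly : Prop :=
  FatHookPairConcavity → PureCooperPair → DiluteBECBridge → HubbardSuperconductivity

/-! D-0027 §2.1 — DECIDING THEOREM (planner-authored via `route open/edit --closes-file`; by planner-rbadge-HubbardSuperconductivity-Hypero-dcd3130e-g2-0 2026-08-15T16:17:57Z):
its hypotheses are this route's items and its conclusion the sub-problem Statement (glue_lint), and it elaborates with this file. -/

@[closes "route-HubbardSuperconductivity-HyperoctahedralMott"] theorem closes : FatHookPairConcavity → PureCooperPair → DiluteBECBridge → _root_.HubbardSuperconductivity := by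
  intro _hAnchor hPair hBridge
  obtain ⟨U, hU, hCP⟩ := hPair
  obtain ⟨δ, hδ, hLRO⟩ := hBridge U hU hCP
  show Literature.Hubbard.DWaveSuperconductivityHubbard
  unfold Literature.Hubbard.DWaveSuperconductivityHubbard
  exact ⟨U, lt_of_lt_of_le two_pos hU.1, δ, hδ, hLRO⟩

end Summit.HubbardSuperconductivity.HubbardSuperconductivity.Theses.HyperoctahedralMott
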